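import Summits.Ventures.HSemireg.Pad4TowerTorusBlind


/-!
# Venture HSemireg — PAD-4 on 𝔅(μ₄): LEMMA P, part 1 — FACTOR PERMUTATIONS OF A TWO-LEVEL SUPPORT; RULE D(μ₄) IS `S₄`-COVARIANT (plan-lens-HodgeAV-negation g2)

HONEST FRAMING. Lean index of the computation cell `pub-hsemireg` (S4-PUSH, H2 door PAD-4, line stmt-HodgeConjecture-18881), written by the
lens seat `plan-lens-HodgeAV-negation` (g2; LENSES-v3 «negation», director-hodge req-36) and carved out of its crux Sketch
`Summits∕HodgeConjecture∕HodgeConjecture∕Cruxes∕BlochSeedDiscOne∕GhostMateThinning.lean` §4 (ec1716aae19efc4e) on the critic's price G3 (idea-crit-6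
L6 ruling, director R16.29∕R16.30); split in two files (≤ 400 lines each) on the fallback filer's gate pre-check (s4-prove-1 g29, 18:28Z). Census-neutral:
theorems ABOUT THE TYPED STATIC PREDICATES of record; nothing here is an object, a σ, a seed or a census row; NOTHING HERE SAYS THAT HC ∕ HC_CM ∕ HC_AV ∕ H2
HOLDS OR FAILS. No `sorry`, no `axiom`, no `instance`, no notation, no Literature fact.

WHAT (this part). `S₄` acts on 𝔅(μ₄) cells by permuting the four factors (`Pad4TowerPermWindow.MCell.perm`, `(Z.perm τ)_f = Z_{τ f}`) and on two-level
configurations by permuting every cell of both levels (`MConfig.permImage τ`, §1). §1 proves the transport lemmas (membership, `∀`∕`∃` over the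
levels, composition `permImage_permImage`, `permImage_one`, and the commuting of `permImage` with the factorwise torus `phaseImage` of
`Pad4TowerStaticTorus`), the re-indexing of the «off one ∕ two factors» agreements (`magree_perm`, `magree2_perm`, `uPartner_perm`) and of the
RULE D primitives (`mServedBelow_perm` … `coveredAbove_perm`). §2: **`ruleDMu4Closed_permImage` — `RuleDMu4Closed (C.permImage τ) ↔ RuleDMu4Closed C`**
(FLAG H-1 of `Pad4TowerRuleDMu4.lean` discharged for RULE D(μ₄)), and `inDiamond_permImage`. PROOF: a factor permutation does not move points, it
re-indexes the factor variables: every per-factor primitive `R (P f) (Z f)` becomes `R (P (τ f)) (Z (τ f))` and the «off one factor» agreement `MAgree`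
re-indexes by `τ`; direction variables are untouched. Part 2 (`Pad4TowerPermCovarianceStatic.lean`) does the same for the X and A2I instance families,
assembles LEMMA P (`staticFamilies_permInvariant_familywise`: with LEMMA T of `Pad4TowerTorusBlind` the static game of record is `(ℤ∕4) ≀ S₄ ⊇ G₁`-invariant)
and builds the `G₁`-hull `satG1` of a support.

SOURCES: `Pad4TowerPermWindow.lean` (`MCell.perm`, `perm_one ∕ perm_mul ∕ perm_injective`), `Pad4TowerRuleDMu4.lean` + `Pad4TowerRuleDMu4Dual.lean`
(`MConfig.sub`, `RuleDMu4N∕P`, the RULE D primitives), `Pad4TowerDiamondMu4.lean` (`InDiamond`), `Pad4TowerStaticTorus.lean` (`MConfig.phaseImage`),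
`Pad4TowerTorusBlindBase.lean` (LEMMA T, whose RULE D section this file mirrors with `perm` for `phase`); negation-seat Sketch `GhostMateThinning.lean`
ec1716aae19efc4e §4 (farm-checked there first). -/

namespace Summit.Ventures.HSemireg.Pad4Tower

open Finset

/-! ## §0 Levelwise inclusion `MConfig.sub` (tree, `Pad4TowerRuleDMu4Dual`) is a preorder -/

/-- `sub` is reflexive. -/
theorem sub_refl (C : MConfig) : C.sub C := ⟨Subset.refl _, Subset.refl _⟩

/-- `sub` is transitive. -/
theorem sub_trans {A B C : MConfig} (h₁ : A.sub B) (h₂ : B.sub C) : A.sub C := ⟨h₁.1.trans h₂.1, h₁.2.trans h₂.2⟩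

/-! ## §1 The factor permutation of a two-level support, and transport of the per-factor primitives -/

section Perm

variable (τ : Equiv.Perm (Fin 4)) (C : MConfig)

/-- the image of a two-level support under a factor permutation (both levels). -/
def MConfig.permImage (τ : Equiv.Perm (Fin 4)) (C : MConfig) : MConfig :=
  ⟨C.lower.image (MCell.perm τ), C.upper.image (MCell.perm τ)⟩

/-- membership in the lower level of the permuted configuration: the cell is the `τ`-permutation of a lower cell of `C`. -/
theorem mem_permImage_lower {X : MCell} : X ∈ (C.permImage τ).lower ↔ ∃ Z ∈ C.lower, Z.perm τ = X := by
  simp [MConfig.permImage, Finset.mem_image]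

/-- membership in the upper level of the permuted configuration: the cell is the `τ`-permutation of an upper cell of `C`. -/
theorem mem_permImage_upper {X : MCell} : X ∈ (C.permImage τ).upper ↔ ∃ P ∈ C.upper, P.perm τ = X := by
  simp [MConfig.permImage, Finset.mem_image]

/-- `Z.perm τ` lies in the lower level of `C.permImage τ` iff `Z` lies in the lower level of `C` (`perm` is injective). -/
theorem perm_mem_permImage_lower {Z : MCell} : Z.perm τ ∈ (C.permImage τ).lower ↔ Z ∈ C.lower := by
  rw [mem_permImage_lower]
  exact ⟨fun ⟨Z', hZ', e⟩ => MCell.perm_injective τ e ▸ hZ', fun h => ⟨Z, h, rfl⟩⟩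

/-- `P.perm τ` lies in the upper level of `C.permImage τ` iff `P` lies in the upper level of `C`. -/
theorem perm_mem_permImage_upper {P : MCell} : P.perm τ ∈ (C.permImage τ).upper ↔ P ∈ C.upper := by
  rw [mem_permImage_upper]
  exact ⟨fun ⟨P', hP', e⟩ => MCell.perm_injective τ e ▸ hP', fun h => ⟨P, h, rfl⟩⟩

/-- a universal statement over the lower level of `C.permImage τ` is the re-indexed statement over the lower level of `C`. -/
theorem forall_permImage_lower {p : MCell → Prop} : (∀ Z ∈ (C.permImage τ).lower, p Z) ↔ ∀ Z ∈ C.lower, p (Z.perm τ) := by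
  constructor
  · intro h Z hZ; exact h _ ((perm_mem_permImage_lower τ C).mpr hZ)
  · intro h X hX; obtain ⟨Z, hZ, rfl⟩ := (mem_permImage_lower τ C).mp hX; exact h Z hZ

/-- a universal statement over the upper level of `C.permImage τ` is the re-indexed statement over the upper level of `C`. -/
theorem forall_permImage_upper {p : MCell → Prop} : (∀ P ∈ (C.permImage τ).upper, p P) ↔ ∀ P ∈ C.upper, p (P.perm τ) := by
  constructor
  · intro h P hP; exact h _ ((perm_mem_permImage_upper τ C).mpr hP)
  · intro h X hX; obtain ⟨P, hP, rfl⟩ := (mem_permImage_upper τ C).mp hX; exact h P hP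

/-- an existential statement over the lower level of `C.permImage τ` is the re-indexed statement over the lower level of `C`. -/
theorem exists_permImage_lower {p : MCell → Prop} : (∃ Z ∈ (C.permImage τ).lower, p Z) ↔ ∃ Z ∈ C.lower, p (Z.perm τ) := by
  constructor
  · rintro ⟨X, hX, hp⟩; obtain ⟨Z, hZ, rfl⟩ := (mem_permImage_lower τ C).mp hX; exact ⟨Z, hZ, hp⟩
  · rintro ⟨Z, hZ, hp⟩; exact ⟨_, (perm_mem_permImage_lower τ C).mpr hZ, hp⟩

/-- an existential statement over the upper level of `C.permImage τ` is the re-indexed statement over the upper level of `C`. -/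
theorem exists_permImage_upper {p : MCell → Prop} : (∃ P ∈ (C.permImage τ).upper, p P) ↔ ∃ P ∈ C.upper, p (P.perm τ) := by
  constructor
  · rintro ⟨X, hX, hp⟩; obtain ⟨P, hP, rfl⟩ := (mem_permImage_upper τ C).mp hX; exact ⟨P, hP, hp⟩
  · rintro ⟨P, hP, hp⟩; exact ⟨_, (perm_mem_permImage_upper τ C).mpr hP, hp⟩

/-- agreement off one factor, permuted. -/
theorem magree_perm (P Z : MCell) (f : Fin 4) : MAgree (P.perm τ) (Z.perm τ) f ↔ MAgree P Z (τ f) := by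
  constructor
  · intro h g hg
    have e := h (τ.symm g) (fun h' => hg (by rw [← h', Equiv.apply_symm_apply]))
    rwa [MCell.perm_apply, MCell.perm_apply, Equiv.apply_symm_apply] at e
  · intro h g hg
    exact h (τ g) (fun h' => hg (τ.injective h'))

/-- agreement off two factors, permuted. -/
theorem magree2_perm (P Z : MCell) (g j : Fin 4) : MAgree2 (P.perm τ) (Z.perm τ) g j ↔ MAgree2 P Z (τ g) (τ j) := by
  constructor
  · intro h f h1 h2
    have e := h (τ.symm f) (fun h' => h1 (by rw [← h', Equiv.apply_symm_apply]))
      (fun h' => h2 (by rw [← h', Equiv.apply_symm_apply]))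
    rwa [MCell.perm_apply, MCell.perm_apply, Equiv.apply_symm_apply] at e
  · intro h f h1 h2
    exact h (τ f) (fun h' => h1 (τ.injective h')) (fun h' => h2 (τ.injective h'))

/-- a leg on factor `f` of the permuted cells is a leg on factor `τ f` (same direction). -/
theorem uPartner_perm (Z q : MCell) (f k : Fin 4) : UPartner (Z.perm τ) (q.perm τ) f k ↔ UPartner Z q (τ f) k := by
  simp only [UPartner, magree_perm, MCell.perm_apply]

/-- RULE D primitive `MServedBelow` re-indexes under a simultaneous factor permutation of the served cell and the server. -/
theorem mServedBelow_perm (Z : MCell) (f k : Fin 4) :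
    MServedBelow (C.permImage τ) (Z.perm τ) f k ↔ MServedBelow C Z (τ f) k := by
  simp only [MServedBelow, exists_permImage_upper, uPartner_perm]

/-- RULE D primitive `MServedAbove` re-indexes under a simultaneous factor permutation of the served cell and the server. -/
theorem mServedAbove_perm (P : MCell) (f k : Fin 4) :
    MServedAbove (C.permImage τ) (P.perm τ) f k ↔ MServedAbove C P (τ f) k := by
  simp only [MServedAbove, exists_permImage_lower, uPartner_perm]

/-- RULE D primitive `SettledBelow` re-indexes under a simultaneous factor permutation (the settled factor becomes `τ⁻¹`-relabelled). -/
theorem settledBelow_perm (Z : MCell) (f k : Fin 4) :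
    SettledBelow (C.permImage τ) (Z.perm τ) f k ↔ SettledBelow C Z (τ f) k := by
  simp only [SettledBelow, mServedBelow_perm]

/-- RULE D primitive `SettledAbove` re-indexes under a simultaneous factor permutation (the settled factor becomes `τ⁻¹`-relabelled). -/
theorem settledAbove_perm (P : MCell) (f k : Fin 4) :
    SettledAbove (C.permImage τ) (P.perm τ) f k ↔ SettledAbove C P (τ f) k := by
  simp only [SettledAbove, mServedAbove_perm]

/-- RULE D primitive `MCoverBelow` re-indexes under a simultaneous factor permutation of cell and server. -/
theorem mCoverBelow_perm (Z : MCell) (g a j b : Fin 4) :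
    MCoverBelow (C.permImage τ) (Z.perm τ) g a j b ↔ MCoverBelow C Z (τ g) a (τ j) b := by
  simp only [MCoverBelow, exists_permImage_upper, magree2_perm, MCell.perm_apply]

/-- RULE D primitive `MCoverAbove` re-indexes under a simultaneous factor permutation of cell and server. -/
theorem mCoverAbove_perm (P : MCell) (g a j b : Fin 4) :
    MCoverAbove (C.permImage τ) (P.perm τ) g a j b ↔ MCoverAbove C P (τ g) a (τ j) b := by
  simp only [MCoverAbove, exists_permImage_lower, magree2_perm, MCell.perm_apply]

/-- RULE D primitive `CoveredBelow` re-indexes under a simultaneous factor permutation of cell and server. -/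
theorem coveredBelow_perm (Z : MCell) (g k j k' : Fin 4) :
    CoveredBelow (C.permImage τ) (Z.perm τ) g k j k' ↔ CoveredBelow C Z (τ g) k (τ j) k' := by
  simp only [CoveredBelow, mCoverBelow_perm, MCell.perm_apply]

/-- RULE D primitive `CoveredAbove` re-indexes under a simultaneous factor permutation of cell and server. -/
theorem coveredAbove_perm (P : MCell) (g k j k' : Fin 4) :
    CoveredAbove (C.permImage τ) (P.perm τ) g k j k' ↔ CoveredAbove C P (τ g) k (τ j) k' := by
  simp only [CoveredAbove, mCoverAbove_perm, MCell.perm_apply]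

/-! ## §2 RULE D(μ₄) is `S₄`-covariant (FLAG H-1 of `Pad4TowerRuleDMu4`, now a theorem) -/

/-- **RULE D at an `N`-cell is `S₄`-covariant.** -/
theorem ruleDMu4N_perm (Z : MCell) : RuleDMu4N (C.permImage τ) (Z.perm τ) ↔ RuleDMu4N C Z := by
  simp only [RuleDMu4N, settledBelow_perm, coveredBelow_perm, MCell.perm_apply]
  constructor
  · intro h g j hgj
    have e := h (τ.symm g) (τ.symm j) (fun h' => hgj (τ.symm.injective h'))
    simpa only [Equiv.apply_symm_apply] using e
  · intro h g j hgj
    exact h (τ g) (τ j) (fun h' => hgj (τ.injective h'))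

/-- **RULE D at a `P`-cell is `S₄`-covariant.** -/
theorem ruleDMu4P_perm (P : MCell) : RuleDMu4P (C.permImage τ) (P.perm τ) ↔ RuleDMu4P C P := by
  simp only [RuleDMu4P, settledAbove_perm, coveredAbove_perm, MCell.perm_apply]
  constructor
  · intro h g j hgj
    have e := h (τ.symm g) (τ.symm j) (fun h' => hgj (τ.symm.injective h'))
    simpa only [Equiv.apply_symm_apply] using e
  · intro h g j hgj
    exact h (τ g) (τ j) (fun h' => hgj (τ.injective h'))

/-- **RULE-D CLOSURE IS `S₄`-COVARIANT** (FLAG H-1 of `Pad4TowerRuleDMu4`, now a theorem). -/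
theorem ruleDMu4Closed_permImage : RuleDMu4Closed (C.permImage τ) ↔ RuleDMu4Closed C := by
  simp only [RuleDMu4Closed, forall_permImage_lower, forall_permImage_upper, ruleDMu4N_perm, ruleDMu4P_perm]

/-- the permuted support lies in the same diamond. -/
theorem inDiamond_permImage {h : ℤ} (hU : C.InDiamond h) : (C.permImage τ).InDiamond h := by
  refine ⟨fun X hX => ?_, fun X hX => ?_⟩
  · obtain ⟨Z, hZ, rfl⟩ := (mem_permImage_lower τ C).mp hX; exact fun f => hU.1 Z hZ (τ f)
  · obtain ⟨P, hP, rfl⟩ := (mem_permImage_upper τ C).mp hX; exact fun f => hU.2 P hP (τ f)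

end Perm

end Summit.Ventures.HSemireg.Pad4Tower
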